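import Mathlib
import HarnessLib
import Summits.HubbardSuperconductivity.HubbardSuperconductivity.Theorems.KLProgrammeKLRegimeCountertermContinuationJD
import Summits.HubbardSuperconductivity.HubbardSuperconductivity.Theorems.KLProgrammeKLRegimeCountertermDegCapProvider

/-!
# Route `KLProgramme` — child Counterterm of crux K3: THE ONE-VOLUME CONSTRUCTION, (E3c) COMPARISON CLASS = THE ADMISSIBILITY CLASS,
# and the PROVIDER for the gen-6 slot `FrameOKDeg ∧ TwoLegSizesMSTQ` (seat hubbard-kl-k3c3-p2, «fixed point on FrameOK's tube»)

Twin of `…CountertermOneVolumeJA` (p500589) on `…CountertermContinuationJD`: the block's (E3c) conjunct is keyed on the admissibility class `A β U μ`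
itself (comparison frames `K′` with `A β U μ K′`), which is what plan g14's (R12) T1a slot `FrameLipschitzFnTD` (K′ over `FrameOKDeg`) delivers when
`A := FrameOKDeg (ctRenMs G) U (nScales β) μ`; everything else verbatim.

* §1 **`ct_oneVolume_thresholdsJD`** — thresholds `c₁, U₀`, ONE volume past any `(Lh, Mh, M0)` with `CL n/L₀ ≤ ½·tol_n`, and at it: every block keyed
  on `A β U μ` (any history `H`, abstract `X`, (E3c) keyed on `A`) yields a frame IN THE CLASS renormalised to HALF tolerance at every scale and real angle.
* §2 **the (MS-Q) room** (plan g14 (R12) T1b: `msBarQ G Q U n := Q.CE · twoLegBar G Q U 1 n` replaces `msBar = klMsKappa · twoLegBar … 1 n`; k3c3-p3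
  MS-BUDGET.md): `ceBudget_room` — below an explicit `U₅(G, Q) > 0`, for every `n, m` and `j ≤ 4`,
  `twoLegBar j m + Σ_{i ≤ n, i < m} Q.CE·twoLegBar 1 i·(Gfr_j(ctRenMs G)·uPow_j·4^{(j−2)m}) ≤ Gfr_j(ctRenMs G)·uPow_j·4^{(j−2)m}` — the consumer reads
  `Q.CE` ONLY through `U₅ = min 1 (1/A) (1/(2B))`, `B = Q.CE·(S₁+S′₁)·(4/3) + 1`.
* §3 `selfMapProviderA_degCap_of_slotBudget'` (the p502024 provider with the cap hypothesis below a `U`-threshold, the form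
  `two_mul_jacksonDeg_le_numeral` delivers) and **`selfMapProviderA_degCapNumeral_of_ceBudget`**: the hypothesis-free PROVIDER for the gen-6 pair
  (frame slot `FrameOK ∧ K.degree ≤ 2^21·16^{nScales β}`, any per-scale conjunct `X` unfolding to the (E3a-MS) decomposition with the `Q.CE`-keyed budget
  — `TwoLegSizesMSFnQ … K.eval` by `fun h => h` once the bundle lands).
Proofs only; nothing is asserted about the Hubbard model.
-/

noncomputable section

namespace Summit.HubbardSuperconductivity.HubbardSuperconductivity.Theorems.KLRegimeSplit

set_option linter.dupNamespace false -- summit = problem name (single-conjunct summit), D-0017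

open Real Finset
open Literature.MathematicalPhysics.QuantumLattice Literature.Probability.LatticeModels
open Summit.HubbardSuperconductivity.HubbardSuperconductivity.Theorems.KLProgrammeLegKernels

/-! ## §1 The thresholds of the one-volume construction, (E3c) keyed on the class -/

/-- **THRESHOLDS AND THE VOLUME OF CHILD 2's CONSTRUCTION, (E3c) COMPARISON CLASS = THE ADMISSIBILITY CLASS.**  As `ct_oneVolume_thresholdsJA`
(frame class `A β U μ` inside `FrameOK (ctRenMs G) U (nScales β) μ` via `hAF` — used by the exact reading only; abstract `X`; PROVIDER `hsmP`), with the
block's frame-Lipschitz conjunct ranging over comparison frames IN THE CLASS: there are `c₁ > 0` and `U₀(c) > 0` such that in the regime, for any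
thresholds `Lh, Mh, M0` and rates `CL n ≥ 0`, ONE volume `(L₀, M₀)` past them with `CL n / L₀ ≤ ½·tol_n` carries, for EVERY such block (any history `H`),
a frame IN THE CLASS whose local parts are within HALF the quadratic tolerance at every scale and every real angle. -/
theorem ct_oneVolume_thresholdsJD (G : GeoConsts) (Q : EngConsts) (hG : G.WF) (hQ : Q.WF)
    (A : ℝ → ℝ → ℝ → TrigPolyC4v → Prop) (hAF : ∀ β U μ : ℝ, ∀ K : TrigPolyC4v, A β U μ K → FrameOK (ctRenMs G) U (nScales β) μ K)
    (X : ∀ (L M : ℕ) [NeZero L] [NeZero M], ℝ → ℝ → ℝ → TrigPolyC4v → ℕ → Prop)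
    (hsmP : ∃ c₄ : ℝ, 0 < c₄ ∧ ∃ U₄ : ℝ, 0 < U₄ ∧ ∀ c U β : ℝ, 0 < c → c ≤ c₄ → 0 < U → U ≤ U₄ →
      klBetaMin ≤ β → β ≤ Real.exp (c / U ^ 2) → ∀ μ ∈ klWindowC,
        A β U μ 0 ∧ ∃ d : ℕ,
          (1 + 4 / 3 * (G.SL + Q.SL * |U|) * |U|) * (1 + 2 * (4 / 3 * (G.SL + Q.SL * |U|) * |U|)) *
              (π ^ 6 / (d + 1) * ∑ i ∈ range (nScales β + 1), twoLegBar G Q U 1 i) ≤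
            |U| * ((16 : ℝ) ^ nScales β)⁻¹ / 256 ∧
          ∀ (L M : ℕ) [NeZero L] [NeZero M],
            ∀ K : TrigPolyC4v, A β U μ K → ∀ n : ℕ, n ≤ nScales β →
              (∀ i ≤ n, X L M β U μ K i) → A β U μ (ctIterJ L M d β U μ K n)) :
    ∃ c₁ : ℝ, 0 < c₁ ∧ ∀ c : ℝ, 0 < c → c ≤ c₁ → ∃ U₀ : ℝ, 0 < U₀ ∧
      ∀ μ ∈ klWindowC, ∀ U : ℝ, 0 < U → U ≤ U₀ → ∀ β : ℝ, klBetaMin ≤ β → β ≤ Real.exp (c / U ^ 2) →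
        ∀ (Lh : ℕ) (Mh M0 : ℕ → ℕ) (CL : ℕ → ℝ), (∀ n, 0 ≤ CL n) →
          ∃ (L₀ M₀ : ℕ), 0 < L₀ ∧ 0 < M₀ ∧ Lh ≤ L₀ ∧ Mh L₀ ≤ M₀ ∧ M0 L₀ ≤ M₀ ∧
            (∀ n ≤ nScales β, CL n / L₀ ≤ ctCr G * |U| * klScale klE0 n ^ 2 / klE0 / 2) ∧
            ∀ (_ : NeZero L₀) (_ : NeZero M₀) (H : TrigPolyC4v → ℕ → Prop),
              (∀ K : TrigPolyC4v, A β U μ K → ∀ n : ℕ, n ≤ nScales β →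
                (∀ j < n, RenormalisedAtF L₀ M₀ β U μ K (ctRenMs G) j) →
                  (IsSymmetricFrame (klTwoLegPieceFn L₀ M₀ β U μ K.eval n) ∧
                    ContDiff ℝ 4 (onM (klTwoLegPieceFn L₀ M₀ β U μ K.eval n)) ∧
                    ∀ j ≤ 2, ∀ q : Momentum,
                      ‖iteratedFDeriv ℝ j (onM (klTwoLegPieceFn L₀ M₀ β U μ K.eval n)) q‖ ≤ twoLegBar G Q U j n) ∧
                    (∀ K' : TrigPolyC4v, A β U μ K' → (∀ j < n, H K' j) → ∀ q : Fin 2 → ℝ,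
                      |klTwoLegPieceFn L₀ M₀ β U μ K.eval n q - klTwoLegPieceFn L₀ M₀ β U μ K'.eval n q| ≤
                        lipBar G Q U n * frameDist K K') ∧ X L₀ M₀ β U μ K n ∧
                      (RenormalisedAtF L₀ M₀ β U μ K (ctRenMs G) n → H K n)) →
              ∃ K : TrigPolyC4v, A β U μ K ∧
                ∀ n ≤ nScales β, ∀ θ : ℝ, |klLocalPart L₀ M₀ β U μ K n θ| ≤ ctCr G * |U| * klScale klE0 n ^ 2 / klE0 / 2 := by
  have hR : ∀ j, 0 ≤ (ctRenMs G).Gfr j := (ctRenMs_WF2 hG).1.2.2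
  have hS0 : 0 ≤ G.S 0 := hG.2.2.2.2.2.2.2.2.2.2.2.2.2.2.2.2.2.1 0
  have hS'0 : 0 ≤ Q.S' 0 := hQ.2.2.2.2.1 0
  have hSL : 0 ≤ G.SL := hG.2.2.2.2.2.2.2.2.2.2.2.2.2.2.2.2.2.2.2
  have hSL' : 0 ≤ Q.SL := hQ.2.2.2.2.2.2.1
  obtain ⟨c₃, hc₃, U₃, hU₃, read⟩ := klLocalPart_eq_partialSumFn_of_frameOK (ctRenMs G) hR
  obtain ⟨c₄, hc₄, U₄, hU₄, smp⟩ := hsmP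
  refine ⟨min c₃ c₄, lt_min hc₃ hc₄, fun c hc hcle => ?_⟩
  have hcc₃ : c ≤ c₃ := hcle.trans (min_le_left _ _)
  have hcc₄ : c ≤ c₄ := hcle.trans (min_le_right _ _)
  have hu₄pos : 0 < 1 / (10 * (Q.S' 0 + 1)) := by positivity
  have hu₅pos : 0 < 3 / (4000 * (G.SL + Q.SL + 1)) := by positivity
  refine ⟨min (min U₃ U₄) (min (min (1 / (10 * (Q.S' 0 + 1))) (3 / (4000 * (G.SL + Q.SL + 1)))) 1),
    lt_min (lt_min hU₃ hU₄) (lt_min (lt_min hu₄pos hu₅pos) one_pos), ?_⟩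
  intro μ hμ U hU hUle β hβ hβc Lh Mh M0 CL hCL
  have hU3 : U ≤ U₃ := hUle.trans ((min_le_left _ _).trans (min_le_left _ _))
  have hU4' : U ≤ U₄ := hUle.trans ((min_le_left _ _).trans (min_le_right _ _))
  have hU4 : U ≤ 1 / (10 * (Q.S' 0 + 1)) := hUle.trans ((min_le_right _ _).trans ((min_le_left _ _).trans (min_le_left _ _)))
  have hU5 : U ≤ 3 / (4000 * (G.SL + Q.SL + 1)) :=
    hUle.trans ((min_le_right _ _).trans ((min_le_left _ _).trans (min_le_right _ _)))
  have hU1 : U ≤ 1 := hUle.trans ((min_le_right _ _).trans (min_le_right _ _))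
  have hS0' : Q.S' 0 * |U| ≤ 1 / 10 := sPrime_zero_mul_abs_le hS'0 hU hU4
  have hq : 4 / 3 * (G.SL + Q.SL * |U|) * |U| ≤ 1 / 1000 := contraction_le hSL hSL' hU hU1 hU5
  obtain ⟨hzero, d, hdcond, smpStep⟩ := smp c U β hc hcc₄ hU hU4' hβ hβc μ hμ
  -- the construction volume: only the rates `CL n / L₀ ≤ ½·tol_n` constrain it
  have htpos : ∀ n ≤ nScales β, 0 < ctCr G * |U| * klScale klE0 n ^ 2 / klE0 / 2 := by
    intro n _
    have hUa : 0 < |U| := abs_pos.2 hU.ne'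
    have hcr0 : 0 < ctCr G := by unfold ctCr; positivity
    have he0 : (0 : ℝ) < klE0 := by norm_num [klE0]
    have hΛ : 0 < klScale klE0 n := by unfold klScale; positivity
    positivity
  obtain ⟨L₀, hL₀pos, hL₀min, hL₀rate⟩ :=
    exists_volume_threshold (N := nScales β) (a := CL) (t := fun n => ctCr G * |U| * klScale klE0 n ^ 2 / klE0 / 2)
      (fun n _ => hCL n) htpos Lh
  have hM₀pos : 0 < max (Mh L₀) (M0 L₀) + 1 := Nat.succ_pos _
  refine ⟨L₀, max (Mh L₀) (M0 L₀) + 1, hL₀pos, hM₀pos, hL₀min, (le_max_left _ _).trans (Nat.le_succ _),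
    (le_max_right _ _).trans (Nat.le_succ _), fun n hn => hL₀rate n hn, ?_⟩
  intro _ _ H blk
  -- the Jackson degree `d` comes from the provider with its displacement condition at `m = N`; monotone in `m`
  set qq : ℝ := 4 / 3 * (G.SL + Q.SL * |U|) * |U| with hqq
  set B1 : ℝ := ∑ i ∈ range (nScales β + 1), twoLegBar G Q U 1 i with hB1
  have hB1 : 0 ≤ B1 := sum_nonneg fun i _ => twoLegBar_nonneg' hG hQ U 1 i
  have hqq0 : 0 ≤ qq := by positivity
  set η : ℝ := π ^ 6 / (d + 1) * B1 with hηdef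
  have hη : π ^ 6 / (d + 1) * ∑ i ∈ range (nScales β + 1), twoLegBar G Q U 1 i ≤ η := le_rfl
  have hηw : ∀ m ≤ nScales β, (1 + qq) * (1 + 2 * qq) * η ≤ |U| * ((16 : ℝ) ^ m)⁻¹ / 256 := by
    intro m hm
    have hmono : |U| * ((16 : ℝ) ^ nScales β)⁻¹ / 256 ≤ |U| * ((16 : ℝ) ^ m)⁻¹ / 256 := by
      have : ((16 : ℝ) ^ nScales β)⁻¹ ≤ ((16 : ℝ) ^ m)⁻¹ :=
        inv_anti₀ (by positivity) (pow_le_pow_right₀ (by norm_num) hm)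
      have hUa : 0 ≤ |U| := abs_nonneg U
      nlinarith
    have hkey : (1 + qq) * (1 + 2 * qq) * η ≤ |U| * ((16 : ℝ) ^ nScales β)⁻¹ / 256 := by
      rw [hηdef]; exact hdcond
    exact hkey.trans hmono
  -- the self-map at this volume and degree, from the provider
  have hsm : ∀ K : TrigPolyC4v, A β U μ K → ∀ n : ℕ, n ≤ nScales β →
      (∀ i ≤ n, X L₀ (max (Mh L₀) (M0 L₀) + 1) β U μ K i) →
        A β U μ (ctIterJ L₀ (max (Mh L₀) (M0 L₀) + 1) d β U μ K n) :=
    fun K hK n hn hX => smpStep L₀ (max (Mh L₀) (M0 L₀) + 1) K hK n hn hX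
  -- the reading at the construction volume is EXACT
  have hread : ∀ K : TrigPolyC4v, A β U μ K → ∀ n : ℕ, n ≤ nScales β → ∀ B : ℝ,
      (∀ q : Fin 2 → ℝ, |K.eval q + ∑ i ∈ range (n + 1),
        klTwoLegPieceFn L₀ (max (Mh L₀) (M0 L₀) + 1) β U μ K.eval i q| ≤ B) →
        ∀ θ : ℝ, |klLocalPart L₀ (max (Mh L₀) (M0 L₀) + 1) β U μ K n θ| ≤ B := by
    intro K hK n _ B hB θ
    rw [read c hc hcc₃ U hU hU3 β hβ hβc μ hμ μ K (hAF β U μ K hK) L₀ (max (Mh L₀) (M0 L₀) + 1) n θ]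
    exact hB _
  exact ct_oneVolume_of_readingJED (L := L₀) (M := max (Mh L₀) (M0 L₀) + 1) hG hQ rfl blk hread hS0' hq hzero d hsm hη hηw

/-! ## §2 The (MS-Q) room: `Q.CE`-keyed slot budgets against `ctRenMs G` -/

/-- **The (MS-Q) room.**  With `msBarQ G Q U i = Q.CE·twoLegBar G Q U 1 i` in place of `msBar` (plan g14 (R12) T1b), the own-slot size plus the
fine-slot budgets of the pieces `i ≤ n` landing in slot `m` fit in `ctRenMs G`'s slot-`m` allowance, for EVERY `n, m` and `j ≤ 4`, once
`0 < U ≤ U₅ := min 1 (min (1/A) (1/(2B)))`, `A = Σ_{j≤4} S′_j + 1`, `B = Q.CE·(S₁ + S′₁)·(4/3) + 1` (so `2(S_j + S′_j U) ≤ Gfr_j` and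
`Q.CE·Σ_i twoLegBar 1 i ≤ ½`). -/
theorem ceBudget_room (G : GeoConsts) (Q : EngConsts) (hG : G.WF) (hQ : Q.WF) :
    ∃ U₅ : ℝ, 0 < U₅ ∧ ∀ U : ℝ, 0 < U → U ≤ U₅ → ∀ n m : ℕ, ∀ j ≤ 4,
      twoLegBar G Q U j m +
          ∑ i ∈ (range (n + 1)).filter (· < m),
            Q.CE * twoLegBar G Q U 1 i * ((ctRenMs G).Gfr j * uPow j U * (4 : ℝ) ^ (((j : ℤ) - 2) * m)) ≤
        (ctRenMs G).Gfr j * uPow j U * (4 : ℝ) ^ (((j : ℤ) - 2) * m) := by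
  have hS : ∀ j, 0 ≤ G.S j := hG.2.2.2.2.2.2.2.2.2.2.2.2.2.2.2.2.2.1
  have hS' : ∀ j, 0 ≤ Q.S' j := hQ.2.2.2.2.1
  have hCE : 0 ≤ Q.CE := hQ.1
  have hR : ∀ j, 0 ≤ (ctRenMs G).Gfr j := (ctRenMs_WF2 hG).1.2.2
  set A : ℝ := Q.S' 0 + Q.S' 1 + Q.S' 2 + Q.S' 3 + Q.S' 4 + 1 with hA_def
  set B : ℝ := Q.CE * (G.S 1 + Q.S' 1) * (4 / 3) + 1 with hB_def
  have hA : 0 < A := by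
    have := hS' 0; have := hS' 1; have := hS' 2; have := hS' 3; have := hS' 4
    rw [hA_def]; linarith
  have hB : 0 < B := by rw [hB_def]; have := hS' 1; have := hS 1; positivity
  refine ⟨min 1 (min (1 / A) (1 / (2 * B))), lt_min one_pos (lt_min (by positivity) (by positivity)), ?_⟩
  intro U hU hUle n m j hj
  have hU1 : U ≤ 1 := hUle.trans (min_le_left _ _)
  have hUA : U ≤ 1 / A := (hUle.trans (min_le_right _ _)).trans (min_le_left _ _)
  have hUB : U ≤ 1 / (2 * B) := (hUle.trans (min_le_right _ _)).trans (min_le_right _ _)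
  have habs : |U| = U := abs_of_pos hU
  -- (ha): `2(S_j + S′_j|U|) ≤ Gfr_j`
  have hroomA : 2 * (G.S j + Q.S' j * |U|) ≤ (ctRenMs G).Gfr j := by
    refine ctRenMs_room G hQ hU.le ?_ j hj
    have := (le_div_iff₀ hA).mp hUA
    linarith
  -- (hb′): `Q.CE·Σ_{i ≤ n} twoLegBar 1 i ≤ ½`
  have hsum1 : ∑ i ∈ range (n + 1), twoLegBar G Q U 1 i ≤ 4 / 3 * (G.S 1 + Q.S' 1 * |U|) * U ^ 2 :=
    sum_twoLegBar_one_le G Q U (by have := hS 1; have := hS' 1; positivity) (n + 1)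
  have hroomB : Q.CE * ∑ i ∈ range (n + 1), twoLegBar G Q U 1 i ≤ 1 / 2 := by
    have h2B : 0 < 2 * B := by positivity
    have hle := (le_div_iff₀ h2B).mp hUB
    have hS1 := hS 1; have hS1' := hS' 1
    have hstep : Q.CE * (4 / 3 * (G.S 1 + Q.S' 1 * |U|) * U ^ 2) ≤ B * U := by
      rw [habs]
      have ha : 0 ≤ Q.CE * (G.S 1 + Q.S' 1 * U) := by positivity
      have hb : 0 ≤ Q.CE * (G.S 1 + Q.S' 1) := by positivity
      have hU0 := hU.le
      calc Q.CE * (4 / 3 * (G.S 1 + Q.S' 1 * U) * U ^ 2)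
            = Q.CE * (G.S 1 + Q.S' 1 * U) * U * U * (4 / 3) := by ring
        _ ≤ Q.CE * (G.S 1 + Q.S' 1 * U) * U * 1 * (4 / 3) := by gcongr
        _ ≤ Q.CE * (G.S 1 + Q.S' 1 * 1) * U * 1 * (4 / 3) := by gcongr
        _ ≤ B * U := by rw [hB_def]; nlinarith
    calc Q.CE * ∑ i ∈ range (n + 1), twoLegBar G Q U 1 i ≤ Q.CE * (4 / 3 * (G.S 1 + Q.S' 1 * |U|) * U ^ 2) :=
          mul_le_mul_of_nonneg_left hsum1 hCE
      _ ≤ B * U := hstep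
      _ ≤ 1 / 2 := by linarith
  -- assemble
  set W : ℝ := (ctRenMs G).Gfr j * uPow j U * (4 : ℝ) ^ (((j : ℤ) - 2) * m) with hW
  have hW0 : 0 ≤ W := by rw [hW]; exact mul_nonneg (mul_nonneg (hR j) (uPow_nonneg j U)) (zpow_nonneg (by norm_num) _)
  have hfil : ∑ i ∈ (range (n + 1)).filter (· < m), Q.CE * twoLegBar G Q U 1 i * W ≤
      ∑ i ∈ range (n + 1), Q.CE * twoLegBar G Q U 1 i * W :=
    sum_le_sum_of_subset_of_nonneg (filter_subset _ _) fun i _ _ =>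
      mul_nonneg (mul_nonneg hCE (twoLegBar_nonneg' hG hQ U 1 i)) hW0
  have hsumW : ∑ i ∈ range (n + 1), Q.CE * twoLegBar G Q U 1 i * W = (Q.CE * ∑ i ∈ range (n + 1), twoLegBar G Q U 1 i) * W := by
    rw [mul_sum, sum_mul]
  have hown : twoLegBar G Q U j m ≤ 1 / 2 * W := by
    rw [hW, twoLegBar]
    have hu : 0 ≤ uPow j U * (4 : ℝ) ^ (((j : ℤ) - 2) * m) := mul_nonneg (uPow_nonneg j U) (zpow_nonneg (by norm_num) _)
    calc (G.S j + Q.S' j * |U|) * uPow j U * (4 : ℝ) ^ (((j : ℤ) - 2) * m)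
          = (G.S j + Q.S' j * |U|) * (uPow j U * (4 : ℝ) ^ (((j : ℤ) - 2) * m)) := by ring
      _ ≤ (1 / 2 * (ctRenMs G).Gfr j) * (uPow j U * (4 : ℝ) ^ (((j : ℤ) - 2) * m)) :=
          mul_le_mul_of_nonneg_right (by linarith) hu
      _ = _ := by ring
  calc twoLegBar G Q U j m + ∑ i ∈ (range (n + 1)).filter (· < m), Q.CE * twoLegBar G Q U 1 i * W
        ≤ 1 / 2 * W + (Q.CE * ∑ i ∈ range (n + 1), twoLegBar G Q U 1 i) * W := by
          rw [← hsumW]; exact add_le_add hown hfil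
    _ ≤ 1 / 2 * W + 1 / 2 * W := by gcongr
    _ = W := by ring

/-! ## §3 Providers for the gen-6 pair (degree-capped frame slot, `Q.CE`-keyed (E3a-MS)) -/

/-- **Provider for the DEGREE-CAPPED class with an ABSTRACT (E3a-MS) conjunct, cap below a `U`-threshold**: `selfMapProviderA_degCap_of_slotBudget`
(p502024) verbatim except that `hcap` is asked only for `0 < U ≤ U₆` (the form `two_mul_jacksonDeg_le_numeral` delivers). -/
theorem selfMapProviderA_degCap_of_slotBudget' (G : GeoConsts) (Q : EngConsts) (hG : G.WF) (hQ : Q.WF) (cap : ℝ → ℝ → ℕ)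
    (hcap : ∃ U₆ : ℝ, 0 < U₆ ∧ ∀ U β : ℝ, 0 < U → U ≤ U₆ → klBetaMin ≤ β →
      2 * ⌈π ^ 6 * (∑ i ∈ range (nScales β + 1), twoLegBar G Q U 1 i) *
            ((1 + 4 / 3 * (G.SL + Q.SL * |U|) * |U|) * (1 + 2 * (4 / 3 * (G.SL + Q.SL * |U|) * |U|))) /
          (|U| * ((16 : ℝ) ^ nScales β)⁻¹ / 256)⌉₊ ≤ cap β U)
    (X : ∀ (L M : ℕ) [NeZero L] [NeZero M], ℝ → ℝ → ℝ → TrigPolyC4v → ℕ → Prop) (B : ℝ → ℕ → ℕ → ℕ → ℝ)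
    (hB : ∀ U i m j, 0 ≤ B U i m j)
    (hX : ∀ (L M : ℕ) [NeZero L] [NeZero M] (β U μ : ℝ) (K : TrigPolyC4v) (i : ℕ), X L M β U μ K i →
      ∃ lp : ℕ → FrameFn,
        (∀ p : Fin 2 → ℝ, klTwoLegPieceFn L M β U μ K.eval i p = lp i p + ∑ m ∈ Ioc i (nScales β), lp m p) ∧
        (∀ m, IsSymmetricFrame (lp m) ∧ ContDiff ℝ 4 (onM (lp m))) ∧
        (∀ j ≤ 4, ∀ q : Momentum, ‖iteratedFDeriv ℝ j (onM (lp i)) q‖ ≤ twoLegBar G Q U j i) ∧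
        (∀ m ∈ Ioc i (nScales β), ∀ j ≤ 4, ∀ q : Momentum, ‖iteratedFDeriv ℝ j (onM (lp m)) q‖ ≤ B U i m j))
    {U₅ : ℝ} (hU₅ : 0 < U₅)
    (hXroom : ∀ U : ℝ, 0 < U → U ≤ U₅ → ∀ n m : ℕ, ∀ j ≤ 4,
      twoLegBar G Q U j m + ∑ i ∈ (range (n + 1)).filter (· < m), B U i m j ≤
        (ctRenMs G).Gfr j * uPow j U * (4 : ℝ) ^ (((j : ℤ) - 2) * m)) :
    ∃ c₄ : ℝ, 0 < c₄ ∧ ∃ U₄ : ℝ, 0 < U₄ ∧ ∀ c U β : ℝ, 0 < c → c ≤ c₄ → 0 < U → U ≤ U₄ →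
      klBetaMin ≤ β → β ≤ Real.exp (c / U ^ 2) → ∀ μ ∈ klWindowC,
        (FrameOK (ctRenMs G) U (nScales β) μ 0 ∧ (0 : TrigPolyC4v).degree ≤ cap β U) ∧ ∃ d : ℕ,
          (1 + 4 / 3 * (G.SL + Q.SL * |U|) * |U|) * (1 + 2 * (4 / 3 * (G.SL + Q.SL * |U|) * |U|)) *
              (π ^ 6 / (d + 1) * ∑ i ∈ range (nScales β + 1), twoLegBar G Q U 1 i) ≤
            |U| * ((16 : ℝ) ^ nScales β)⁻¹ / 256 ∧
          ∀ (L M : ℕ) [NeZero L] [NeZero M],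
            ∀ K : TrigPolyC4v, (FrameOK (ctRenMs G) U (nScales β) μ K ∧ K.degree ≤ cap β U) → ∀ n : ℕ, n ≤ nScales β →
              (∀ i ≤ n, X L M β U μ K i) →
                FrameOK (ctRenMs G) U (nScales β) μ (ctIterJ L M d β U μ K n) ∧ (ctIterJ L M d β U μ K n).degree ≤ cap β U := by
  have hR : ∀ j, 0 ≤ (ctRenMs G).Gfr j := (ctRenMs_WF2 hG).1.2.2
  obtain ⟨c₂, hc₂, U₂, hU₂, thr⟩ := ctRenMs_thresholds (G := G) (Q := Q) hG hQ
  obtain ⟨U₆, hU₆, hcap⟩ := hcap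
  refine ⟨c₂, hc₂, min (min U₂ U₅) U₆, lt_min (lt_min hU₂ hU₅) hU₆, fun c U β hc hcc hU hUU hβ hβc μ hμ => ?_⟩
  have hUU₂ : U ≤ U₂ := hUU.trans ((min_le_left _ _).trans (min_le_left _ _))
  have hUU₅ : U ≤ U₅ := hUU.trans ((min_le_left _ _).trans (min_le_right _ _))
  have hUU₆ : U ≤ U₆ := hUU.trans (min_le_right _ _)
  obtain ⟨-, -, h0, h1, h2⟩ := thr c U β hc.le hcc hU hUU₂ hβ hβc
  have hμw : μ ∈ Set.Icc (-1.05 : ℝ) (-0.15) := hμ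
  have ht : 0 < |U| * ((16 : ℝ) ^ nScales β)⁻¹ / 256 := by have hUa : 0 < |U| := abs_pos.2 hU.ne'; positivity
  set d : ℕ := ⌈π ^ 6 * (∑ i ∈ range (nScales β + 1), twoLegBar G Q U 1 i) *
      ((1 + 4 / 3 * (G.SL + Q.SL * |U|) * |U|) * (1 + 2 * (4 / 3 * (G.SL + Q.SL * |U|) * |U|))) /
        (|U| * ((16 : ℝ) ^ nScales β)⁻¹ / 256)⌉₊ with hd
  have hdcap : d + d ≤ cap β U := by have := hcap U β hU hUU₆ hβ; rw [← hd] at this; omega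
  refine ⟨⟨frameOK_zero_of_sums hR hμw h0 h1 h2, Nat.zero_le _⟩, d, jacksonDeg_cond _ _ ht, fun L M _ _ K hK n hn hXn => ⟨?_, ?_⟩⟩
  · exact frameOK_jackson_of_slotBudget (L := L) (M := M) hG hQ hR hn hμw (B := B U) (hB U)
      (fun i hi => hX L M β U μ K i (hXn i hi)) (fun m _ j hj => hXroom U hU hUU₅ n m j hj) h0 h1 h2 d
  · rw [ctIterJ_degree]; exact hdcap

/-- **THE PROVIDER FOR THE GEN-6 PAIR, hypothesis-free**: frame slot `FrameOK (ctRenMs G) U (nScales β) μ K ∧ K.degree ≤ 2^21·16^{nScales β}`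
(plan g14 (R12) T1a `FrameOKDeg`, `klFrameDeg N := 2^21·16^N`), per-scale conjunct ANY `X` whose instances unfold to the (E3a-MS) slot decomposition
with the `Q.CE`-keyed fine budgets `Q.CE·twoLegBar G Q U 1 i·(Gfr_j(ctRenMs G)·uPow_j U·4^{(j−2)m})` (T1b `TwoLegSizesMSFnQ … (ctRenMs G) … K.eval i`
is such an `X` by `fun h => h`).  Zero frame, canonical Jackson degree under the cap (`two_mul_jacksonDeg_le_numeral`), and the step
(`frameOK_jackson_of_slotBudget` in the room `ceBudget_room`; degree `d + d` by `rfl`). -/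
theorem selfMapProviderA_degCapNumeral_of_ceBudget (G : GeoConsts) (Q : EngConsts) (hG : G.WF) (hQ : Q.WF)
    (X : ∀ (L M : ℕ) [NeZero L] [NeZero M], ℝ → ℝ → ℝ → TrigPolyC4v → ℕ → Prop)
    (hX : ∀ (L M : ℕ) [NeZero L] [NeZero M] (β U μ : ℝ) (K : TrigPolyC4v) (i : ℕ), X L M β U μ K i →
      ∃ lp : ℕ → FrameFn,
        (∀ p : Fin 2 → ℝ, klTwoLegPieceFn L M β U μ K.eval i p = lp i p + ∑ m ∈ Ioc i (nScales β), lp m p) ∧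
        (∀ m, IsSymmetricFrame (lp m) ∧ ContDiff ℝ 4 (onM (lp m))) ∧
        (∀ j ≤ 4, ∀ q : Momentum, ‖iteratedFDeriv ℝ j (onM (lp i)) q‖ ≤ twoLegBar G Q U j i) ∧
        (∀ m ∈ Ioc i (nScales β), ∀ j ≤ 4, ∀ q : Momentum, ‖iteratedFDeriv ℝ j (onM (lp m)) q‖ ≤
          Q.CE * twoLegBar G Q U 1 i * ((ctRenMs G).Gfr j * uPow j U * (4 : ℝ) ^ (((j : ℤ) - 2) * m)))) :
    ∃ c₄ : ℝ, 0 < c₄ ∧ ∃ U₄ : ℝ, 0 < U₄ ∧ ∀ c U β : ℝ, 0 < c → c ≤ c₄ → 0 < U → U ≤ U₄ →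
      klBetaMin ≤ β → β ≤ Real.exp (c / U ^ 2) → ∀ μ ∈ klWindowC,
        (FrameOK (ctRenMs G) U (nScales β) μ 0 ∧ (0 : TrigPolyC4v).degree ≤ 2 ^ 21 * 16 ^ nScales β) ∧ ∃ d : ℕ,
          (1 + 4 / 3 * (G.SL + Q.SL * |U|) * |U|) * (1 + 2 * (4 / 3 * (G.SL + Q.SL * |U|) * |U|)) *
              (π ^ 6 / (d + 1) * ∑ i ∈ range (nScales β + 1), twoLegBar G Q U 1 i) ≤
            |U| * ((16 : ℝ) ^ nScales β)⁻¹ / 256 ∧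
          ∀ (L M : ℕ) [NeZero L] [NeZero M],
            ∀ K : TrigPolyC4v, (FrameOK (ctRenMs G) U (nScales β) μ K ∧ K.degree ≤ 2 ^ 21 * 16 ^ nScales β) →
              ∀ n : ℕ, n ≤ nScales β → (∀ i ≤ n, X L M β U μ K i) →
                FrameOK (ctRenMs G) U (nScales β) μ (ctIterJ L M d β U μ K n) ∧
                  (ctIterJ L M d β U μ K n).degree ≤ 2 ^ 21 * 16 ^ nScales β := by
  obtain ⟨U₅, hU₅, hroom⟩ := ceBudget_room G Q hG hQ
  have hCE : 0 ≤ Q.CE := hQ.1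
  have hR : ∀ j, 0 ≤ (ctRenMs G).Gfr j := (ctRenMs_WF2 hG).1.2.2
  exact selfMapProviderA_degCap_of_slotBudget' G Q hG hQ (fun β _ => 2 ^ 21 * 16 ^ nScales β)
    (two_mul_jacksonDeg_le_numeral G Q hG hQ) X
    (fun U i m j => Q.CE * twoLegBar G Q U 1 i * ((ctRenMs G).Gfr j * uPow j U * (4 : ℝ) ^ (((j : ℤ) - 2) * m)))
    (fun U i m j => mul_nonneg (mul_nonneg hCE (twoLegBar_nonneg' hG hQ U 1 i))
      (mul_nonneg (mul_nonneg (hR j) (uPow_nonneg j U)) (zpow_nonneg (by norm_num) _)))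
    hX hU₅ hroom

end Summit.HubbardSuperconductivity.HubbardSuperconductivity.Theorems.KLRegimeSplit

end
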